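import Summits.MatrixMultiplication.MatrixMultiplication.Theorems.SoloBlindTriangleQuotZsf

/-!
# Two triples through a point: shape of the members (solo-blind s80)

On a zero-sum-free SET with an H-good target `τ`, two 3-term representations meet in exactly one
point.  Setting: `{v, x1, x2}` and `{v, y1, y2}` both sum to `τ` (five distinct elements of the
zero-sum-free `S`, exponent 3, `τ` H-good).  K3.23.17 (i) of the programme notes: an arbitrary
representation `M ⊆ S` of `τ` meets the pentad in one of EIGHTEEN patterns — the two triples,
`{x_i, y_j}`, `{v, x_i, y_j}`, `{v, z}`, or both points of one pair with one point of the other —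
each of the remaining 14 patterns being killed by an explicit zero-sum or `(τ+τ)`-sum certificate.
This gives the sixteen-target exact formula for the Kraft mass in the case `N_3 = 2`
(K3.23.17 (ii)).  Contents: `soloBlindPentad`, the splitting identity, the predicate
`soloBlindPentadShape`, the halves `v ∈ M` / `v ∉ M` (16 generated cases each) and the assembled
`soloBlind_pentad_shape`; only zero-sum freeness and H-goodness are used.
-/

namespace Summit.MatrixMultiplication.MatrixMultiplication.Theorems

open Finset

universe u

variable {ι : Type*} [DecidableEq ι]
variable {G : Type u} [AddCommGroup G]

/-- The five elements of two triples `{v,x1,x2}`, `{v,y1,y2}` through `v`. -/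
def soloBlindPentad (v x1 x2 y1 y2 : ι) : Finset ι := {v, x1, x2, y1, y2}

/-- Splitting a sum over `M` along the five (distinct) pentad elements. -/
theorem soloBlind_pentad_sum_split (h : ι → G) (M : Finset ι) {v x1 x2 y1 y2 : ι}
    (d_v_x1 : v ≠ x1) (d_v_x2 : v ≠ x2) (d_v_y1 : v ≠ y1) (d_v_y2 : v ≠ y2) (d_x1_x2 : x1 ≠ x2)
    (d_x1_y1 : x1 ≠ y1) (d_x1_y2 : x1 ≠ y2) (d_x2_y1 : x2 ≠ y1) (d_x2_y2 : x2 ≠ y2)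
    (d_y1_y2 : y1 ≠ y2) :
    ∑ i ∈ M, h i = (if v ∈ M then h v else 0) + (if x1 ∈ M then h x1 else 0) +
      (if x2 ∈ M then h x2 else 0) + (if y1 ∈ M then h y1 else 0) + (if y2 ∈ M then h y2 else 0) +
      ∑ i ∈ M \ soloBlindPentad v x1 x2 y1 y2, h i := by
  have hsplit := Finset.sum_filter_add_sum_filter_not M
    (fun i => i ∈ soloBlindPentad v x1 x2 y1 y2) (fun i => h i)
  rw [← Finset.sdiff_eq_filter] at hsplit
  rw [← hsplit, Finset.filter_mem_eq_inter, Finset.inter_comm, ← Finset.filter_mem_eq_inter,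
    Finset.sum_filter]
  have e : soloBlindPentad v x1 x2 y1 y2 = insert v (insert x1 (insert x2 {y1, y2})) := rfl
  have N1 : v ∉ insert x1 (insert x2 ({y1, y2} : Finset ι)) := by
    simp only [Finset.mem_insert, Finset.mem_singleton, not_or]
    exact ⟨d_v_x1, d_v_x2, d_v_y1, d_v_y2⟩
  have N2 : x1 ∉ insert x2 ({y1, y2} : Finset ι) := by
    simp only [Finset.mem_insert, Finset.mem_singleton, not_or]
    exact ⟨d_x1_x2, d_x1_y1, d_x1_y2⟩
  have N3 : x2 ∉ ({y1, y2} : Finset ι) := by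
    simp only [Finset.mem_insert, Finset.mem_singleton, not_or]; exact ⟨d_x2_y1, d_x2_y2⟩
  rw [e, Finset.sum_insert N1, Finset.sum_insert N2, Finset.sum_insert N3, Finset.sum_pair d_y1_y2]
  abel

/-- The eighteen admissible patterns in which a representation `M` of `τ` can meet two triples
`{v,x1,x2}`, `{v,y1,y2}` through `v` (K3.23.17 (i)). -/
def soloBlindPentadShape (M : Finset ι) (v x1 x2 y1 y2 : ι) : Prop :=
  (v ∈ M ∧ x1 ∈ M ∧ x2 ∈ M ∧ y1 ∉ M ∧ y2 ∉ M) ∨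
  (v ∈ M ∧ x1 ∉ M ∧ x2 ∉ M ∧ y1 ∈ M ∧ y2 ∈ M) ∨
  (v ∉ M ∧ x1 ∈ M ∧ x2 ∉ M ∧ y1 ∈ M ∧ y2 ∉ M) ∨
  (v ∉ M ∧ x1 ∈ M ∧ x2 ∉ M ∧ y1 ∉ M ∧ y2 ∈ M) ∨
  (v ∉ M ∧ x1 ∉ M ∧ x2 ∈ M ∧ y1 ∈ M ∧ y2 ∉ M) ∨
  (v ∉ M ∧ x1 ∉ M ∧ x2 ∈ M ∧ y1 ∉ M ∧ y2 ∈ M) ∨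
  (v ∈ M ∧ x1 ∈ M ∧ x2 ∉ M ∧ y1 ∈ M ∧ y2 ∉ M) ∨
  (v ∈ M ∧ x1 ∈ M ∧ x2 ∉ M ∧ y1 ∉ M ∧ y2 ∈ M) ∨
  (v ∈ M ∧ x1 ∉ M ∧ x2 ∈ M ∧ y1 ∈ M ∧ y2 ∉ M) ∨
  (v ∈ M ∧ x1 ∉ M ∧ x2 ∈ M ∧ y1 ∉ M ∧ y2 ∈ M) ∨
  (v ∈ M ∧ x1 ∈ M ∧ x2 ∉ M ∧ y1 ∉ M ∧ y2 ∉ M) ∨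
  (v ∈ M ∧ x1 ∉ M ∧ x2 ∈ M ∧ y1 ∉ M ∧ y2 ∉ M) ∨
  (v ∈ M ∧ x1 ∉ M ∧ x2 ∉ M ∧ y1 ∈ M ∧ y2 ∉ M) ∨
  (v ∈ M ∧ x1 ∉ M ∧ x2 ∉ M ∧ y1 ∉ M ∧ y2 ∈ M) ∨
  (v ∉ M ∧ x1 ∈ M ∧ x2 ∈ M ∧ y1 ∈ M ∧ y2 ∉ M) ∨
  (v ∉ M ∧ x1 ∈ M ∧ x2 ∈ M ∧ y1 ∉ M ∧ y2 ∈ M) ∨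
  (v ∉ M ∧ x1 ∈ M ∧ x2 ∉ M ∧ y1 ∈ M ∧ y2 ∈ M) ∨
  (v ∉ M ∧ x1 ∉ M ∧ x2 ∈ M ∧ y1 ∈ M ∧ y2 ∈ M)

set_option maxHeartbeats 1600000 in
/-- Shape classification relative to two triples through a point, half `v ∈ M` (16 generated
cases; the six excluded patterns die by explicit zero-sum certificates). -/
theorem soloBlind_pentad_shape_of_mem (three : ∀ g : G, g + g + g = 0) {h : ι → G}
    {S : Finset ι} (zsf : ∀ T ⊆ S, T.Nonempty → ∑ i ∈ T, h i ≠ 0) {τ : G}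
    {v x1 x2 y1 y2 : ι} (hx1 : x1 ∈ S) (hx2 : x2 ∈ S) (hy1 : y1 ∈ S) (hy2 : y2 ∈ S)
    (d_v_x1 : v ≠ x1) (d_v_x2 : v ≠ x2) (d_v_y1 : v ≠ y1) (d_v_y2 : v ≠ y2) (d_x1_x2 : x1 ≠ x2)
    (d_x1_y1 : x1 ≠ y1) (d_x1_y2 : x1 ≠ y2) (d_x2_y1 : x2 ≠ y1) (d_x2_y2 : x2 ≠ y2)
    (d_y1_y2 : y1 ≠ y2) (hX : h v + h x1 + h x2 = τ) (hY : h v + h y1 + h y2 = τ)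
    {M : Finset ι} (hMS : M ⊆ S) (hM : ∑ i ∈ M, h i = τ) (mv : v ∈ M) :
    soloBlindPentadShape M v x1 x2 y1 y2 := by
  have hx2' : h x2 = τ - h v - h x1 := by rw [← hX]; abel
  have hy2' : h y2 = τ - h v - h y1 := by rw [← hY]; abel
  have hins : ∀ y : ι, y ∈ S → ∀ V : Finset ι, V ⊆ S → insert y V ⊆ S :=
    fun y hy V hV => Finset.insert_subset_iff.mpr ⟨hy, hV⟩
  set U := M \ soloBlindPentad v x1 x2 y1 y2 with hUdef
  have hUS : U ⊆ S := fun i hi => hMS (Finset.mem_sdiff.mp hi).1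
  have hout : ∀ z ∈ soloBlindPentad v x1 x2 y1 y2, z ∉ U := fun z hz hzU =>
    (Finset.mem_sdiff.mp hzU).2 hz
  have hvU : v ∉ U := hout v (by simp [soloBlindPentad])
  have hx1U : x1 ∉ U := hout x1 (by simp [soloBlindPentad])
  have hx2U : x2 ∉ U := hout x2 (by simp [soloBlindPentad])
  have hy1U : y1 ∉ U := hout y1 (by simp [soloBlindPentad])
  have hy2U : y2 ∉ U := hout y2 (by simp [soloBlindPentad])
  have hsplit := (soloBlind_pentad_sum_split h M d_v_x1 d_v_x2 d_v_y1 d_v_y2 d_x1_x2 d_x1_y1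
    d_x1_y2 d_x2_y1 d_x2_y2 d_y1_y2).symm
  rw [hM] at hsplit
  try rw [← hUdef] at hsplit
  unfold soloBlindPentadShape
  by_cases mx1 : x1 ∈ M <;> by_cases mx2 : x2 ∈ M <;> by_cases my1 : y1 ∈ M <;>
    by_cases my2 : y2 ∈ M <;>
    simp only [mv, mx1, mx2, my1, my2, if_true, if_false, add_zero] at hsplit
  · have hU : ∑ i ∈ U, h i = τ - (h v + h x1 + h x2 + h y1 + h y2) := by rw [← hsplit]; abel
    have N1 : x1 ∉ insert x2 U := by
      simp only [Finset.mem_insert, not_or]; exact ⟨d_x1_x2, hx1U⟩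
    exact (zsf (insert x1 (insert x2 U))
      (hins _ hx1 _ (hins _ hx2 _ hUS)) (Finset.insert_nonempty _ _)
      (by rw [Finset.sum_insert N1, Finset.sum_insert hx2U, hU]
          simp only [hx2', hy2']
          exact soloBlind_tri_close three τ (h v) (h x1) (h y1) (0) (0) (0) (0) (by
            (try simp only [zero_smul, add_zero, sub_zero]); abel))).elim
  · have hU : ∑ i ∈ U, h i = τ - (h v + h x1 + h x2 + h y1) := by rw [← hsplit]; abel
    exact (zsf (insert y1 U) (hins _ hy1 _ hUS) (Finset.insert_nonempty _ _)
      (by rw [Finset.sum_insert hy1U, hU]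
          simp only [hx2']
          exact soloBlind_tri_close three τ (h v) (h x1) (h y1) (0) (0) (0) (0) (by
            (try simp only [zero_smul, add_zero, sub_zero]); abel))).elim
  · have hU : ∑ i ∈ U, h i = τ - (h v + h x1 + h x2 + h y2) := by rw [← hsplit]; abel
    exact (zsf (insert y2 U) (hins _ hy2 _ hUS) (Finset.insert_nonempty _ _)
      (by rw [Finset.sum_insert hy2U, hU]
          simp only [hx2', hy2']
          exact soloBlind_tri_close three τ (h v) (h x1) (h y1) (0) (0) (0) (0) (by
            (try simp only [zero_smul, add_zero, sub_zero]); abel))).elim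
  · left; exact ⟨mv, mx1, mx2, my1, my2⟩ -- Y = {v,x1,x2}
  · have hU : ∑ i ∈ U, h i = τ - (h v + h x1 + h y1 + h y2) := by rw [← hsplit]; abel
    exact (zsf (insert x1 U) (hins _ hx1 _ hUS) (Finset.insert_nonempty _ _)
      (by rw [Finset.sum_insert hx1U, hU]
          simp only [hy2']
          exact soloBlind_tri_close three τ (h v) (h x1) (h y1) (0) (0) (0) (0) (by
            (try simp only [zero_smul, add_zero, sub_zero]); abel))).elim
  · (iterate 6 right); left; exact ⟨mv, mx1, mx2, my1, my2⟩ -- Y = {v,x1,y1}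
  · (iterate 7 right); left; exact ⟨mv, mx1, mx2, my1, my2⟩ -- Y = {v,x1,y2}
  · (iterate 10 right); left; exact ⟨mv, mx1, mx2, my1, my2⟩ -- Y = {v,x1}
  · have hU : ∑ i ∈ U, h i = τ - (h v + h x2 + h y1 + h y2) := by rw [← hsplit]; abel
    exact (zsf (insert x2 U) (hins _ hx2 _ hUS) (Finset.insert_nonempty _ _)
      (by rw [Finset.sum_insert hx2U, hU]
          simp only [hx2', hy2']
          exact soloBlind_tri_close three τ (h v) (h x1) (h y1) (0) (0) (0) (0) (by
            (try simp only [zero_smul, add_zero, sub_zero]); abel))).elim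
  · (iterate 8 right); left; exact ⟨mv, mx1, mx2, my1, my2⟩ -- Y = {v,x2,y1}
  · (iterate 9 right); left; exact ⟨mv, mx1, mx2, my1, my2⟩ -- Y = {v,x2,y2}
  · (iterate 11 right); left; exact ⟨mv, mx1, mx2, my1, my2⟩ -- Y = {v,x2}
  · (iterate 1 right); left; exact ⟨mv, mx1, mx2, my1, my2⟩ -- Y = {v,y1,y2}
  · (iterate 12 right); left; exact ⟨mv, mx1, mx2, my1, my2⟩ -- Y = {v,y1}
  · (iterate 13 right); left; exact ⟨mv, mx1, mx2, my1, my2⟩ -- Y = {v,y2}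
  · have hU : ∑ i ∈ U, h i = τ - (h v) := by rw [← hsplit]; abel
    have N1 : x1 ∉ insert x2 (insert y1 (insert y2 U)) := by
      simp only [Finset.mem_insert, not_or]; exact ⟨d_x1_x2, d_x1_y1, d_x1_y2, hx1U⟩
    have N2 : x2 ∉ insert y1 (insert y2 U) := by
      simp only [Finset.mem_insert, not_or]; exact ⟨d_x2_y1, d_x2_y2, hx2U⟩
    have N3 : y1 ∉ insert y2 U := by
      simp only [Finset.mem_insert, not_or]; exact ⟨d_y1_y2, hy1U⟩
    exact (zsf (insert x1 (insert x2 (insert y1 (insert y2 U))))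
      (hins _ hx1 _ (hins _ hx2 _ (hins _ hy1 _ (hins _ hy2 _ hUS)))) (Finset.insert_nonempty _ _)
      (by rw [Finset.sum_insert N1, Finset.sum_insert N2,
            Finset.sum_insert N3, Finset.sum_insert hy2U, hU]
          simp only [hx2', hy2']
          exact soloBlind_tri_close three τ (h v) (h x1) (h y1) (1) (-1) (0) (0) (by
            (try simp only [zero_smul, one_smul, add_zero, sub_zero]); abel))).elim

set_option maxHeartbeats 1600000 in
/-- Shape classification relative to two triples through a point, half `v ∉ M` (16 generated
cases; the eight excluded patterns die by explicit `(τ+τ)`-sum certificates). -/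
theorem soloBlind_pentad_shape_of_not_mem (three : ∀ g : G, g + g + g = 0) {h : ι → G}
    {S : Finset ι} {τ : G} (hgood : ∀ T ⊆ S, ∑ i ∈ T, h i ≠ τ + τ)
    {v x1 x2 y1 y2 : ι} (hv : v ∈ S) (hx1 : x1 ∈ S) (hx2 : x2 ∈ S) (hy1 : y1 ∈ S) (hy2 : y2 ∈ S)
    (d_v_x1 : v ≠ x1) (d_v_x2 : v ≠ x2) (d_v_y1 : v ≠ y1) (d_v_y2 : v ≠ y2) (d_x1_x2 : x1 ≠ x2)
    (d_x1_y1 : x1 ≠ y1) (d_x1_y2 : x1 ≠ y2) (d_x2_y1 : x2 ≠ y1) (d_x2_y2 : x2 ≠ y2)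
    (d_y1_y2 : y1 ≠ y2) (hX : h v + h x1 + h x2 = τ) (hY : h v + h y1 + h y2 = τ)
    {M : Finset ι} (hMS : M ⊆ S) (hM : ∑ i ∈ M, h i = τ) (mv : v ∉ M) :
    soloBlindPentadShape M v x1 x2 y1 y2 := by
  have hx2' : h x2 = τ - h v - h x1 := by rw [← hX]; abel
  have hy2' : h y2 = τ - h v - h y1 := by rw [← hY]; abel
  have hins : ∀ y : ι, y ∈ S → ∀ V : Finset ι, V ⊆ S → insert y V ⊆ S :=
    fun y hy V hV => Finset.insert_subset_iff.mpr ⟨hy, hV⟩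
  set U := M \ soloBlindPentad v x1 x2 y1 y2 with hUdef
  have hUS : U ⊆ S := fun i hi => hMS (Finset.mem_sdiff.mp hi).1
  have hout : ∀ z ∈ soloBlindPentad v x1 x2 y1 y2, z ∉ U := fun z hz hzU =>
    (Finset.mem_sdiff.mp hzU).2 hz
  have hvU : v ∉ U := hout v (by simp [soloBlindPentad])
  have hx1U : x1 ∉ U := hout x1 (by simp [soloBlindPentad])
  have hx2U : x2 ∉ U := hout x2 (by simp [soloBlindPentad])
  have hy1U : y1 ∉ U := hout y1 (by simp [soloBlindPentad])
  have hy2U : y2 ∉ U := hout y2 (by simp [soloBlindPentad])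
  have hsplit := (soloBlind_pentad_sum_split h M d_v_x1 d_v_x2 d_v_y1 d_v_y2 d_x1_x2 d_x1_y1
    d_x1_y2 d_x2_y1 d_x2_y2 d_y1_y2).symm
  rw [hM] at hsplit
  try rw [← hUdef] at hsplit
  unfold soloBlindPentadShape
  by_cases mx1 : x1 ∈ M <;> by_cases mx2 : x2 ∈ M <;> by_cases my1 : y1 ∈ M <;>
    by_cases my2 : y2 ∈ M <;>
    simp only [mv, mx1, mx2, my1, my2, if_true, if_false, zero_add, add_zero] at hsplit
  · have hU : ∑ i ∈ U, h i = τ - (h x1 + h x2 + h y1 + h y2) := by rw [← hsplit]; abel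
    exact (hgood (insert v U) (hins _ hv _ hUS)
      (by rw [Finset.sum_insert hvU, hU]
          simp only [hx2', hy2']
          exact soloBlind_tri_close three τ (h v) (h x1) (h y1) (-1) (1) (0) (0) (by
            (try simp only [zero_smul, one_smul, add_zero]); abel))).elim
  · (iterate 14 right); left; exact ⟨mv, mx1, mx2, my1, my2⟩ -- Y = {x1,x2,y1}
  · (iterate 15 right); left; exact ⟨mv, mx1, mx2, my1, my2⟩ -- Y = {x1,x2,y2}
  · have hU : ∑ i ∈ U, h i = τ - (h x1 + h x2) := by rw [← hsplit]; abel
    have N1 : v ∉ insert x1 (insert x2 (insert y1 (insert y2 U))) := by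
      simp only [Finset.mem_insert, not_or]; exact ⟨d_v_x1, d_v_x2, d_v_y1, d_v_y2, hvU⟩
    have N2 : x1 ∉ insert x2 (insert y1 (insert y2 U)) := by
      simp only [Finset.mem_insert, not_or]; exact ⟨d_x1_x2, d_x1_y1, d_x1_y2, hx1U⟩
    have N3 : x2 ∉ insert y1 (insert y2 U) := by
      simp only [Finset.mem_insert, not_or]; exact ⟨d_x2_y1, d_x2_y2, hx2U⟩
    have N4 : y1 ∉ insert y2 U := by
      simp only [Finset.mem_insert, not_or]; exact ⟨d_y1_y2, hy1U⟩
    exact (hgood (insert v (insert x1 (insert x2 (insert y1 (insert y2 U)))))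
      (hins _ hv _ (hins _ hx1 _ (hins _ hx2 _ (hins _ hy1 _ (hins _ hy2 _ hUS)))))
      (by rw [Finset.sum_insert N1, Finset.sum_insert N2, Finset.sum_insert N3,
            Finset.sum_insert N4, Finset.sum_insert hy2U, hU]
          simp only [hx2', hy2']
          exact soloBlind_tri_close three τ (h v) (h x1) (h y1) (0) (0) (0) (0) (by
            (try simp only [zero_smul, add_zero]); abel))).elim
  · (iterate 16 right); left; exact ⟨mv, mx1, mx2, my1, my2⟩ -- Y = {x1,y1,y2}
  · (iterate 2 right); left; exact ⟨mv, mx1, mx2, my1, my2⟩ -- Y = {x1,y1}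
  · (iterate 3 right); left; exact ⟨mv, mx1, mx2, my1, my2⟩ -- Y = {x1,y2}
  · have hU : ∑ i ∈ U, h i = τ - (h x1) := by rw [← hsplit]; abel
    have N1 : v ∉ insert x1 (insert y1 (insert y2 U)) := by
      simp only [Finset.mem_insert, not_or]; exact ⟨d_v_x1, d_v_y1, d_v_y2, hvU⟩
    have N2 : x1 ∉ insert y1 (insert y2 U) := by
      simp only [Finset.mem_insert, not_or]; exact ⟨d_x1_y1, d_x1_y2, hx1U⟩
    have N3 : y1 ∉ insert y2 U := by
      simp only [Finset.mem_insert, not_or]; exact ⟨d_y1_y2, hy1U⟩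
    exact (hgood (insert v (insert x1 (insert y1 (insert y2 U))))
      (hins _ hv _ (hins _ hx1 _ (hins _ hy1 _ (hins _ hy2 _ hUS))))
      (by rw [Finset.sum_insert N1, Finset.sum_insert N2,
            Finset.sum_insert N3, Finset.sum_insert hy2U, hU]
          simp only [hy2']
          exact soloBlind_tri_close three τ (h v) (h x1) (h y1) (0) (0) (0) (0) (by
            (try simp only [zero_smul, add_zero]); abel))).elim
  · (iterate 17 right); exact ⟨mv, mx1, mx2, my1, my2⟩ -- Y = {x2,y1,y2}
  · (iterate 4 right); left; exact ⟨mv, mx1, mx2, my1, my2⟩ -- Y = {x2,y1}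
  · (iterate 5 right); left; exact ⟨mv, mx1, mx2, my1, my2⟩ -- Y = {x2,y2}
  · have hU : ∑ i ∈ U, h i = τ - (h x2) := by rw [← hsplit]; abel
    have N1 : v ∉ insert x2 (insert y1 (insert y2 U)) := by
      simp only [Finset.mem_insert, not_or]; exact ⟨d_v_x2, d_v_y1, d_v_y2, hvU⟩
    have N2 : x2 ∉ insert y1 (insert y2 U) := by
      simp only [Finset.mem_insert, not_or]; exact ⟨d_x2_y1, d_x2_y2, hx2U⟩
    have N3 : y1 ∉ insert y2 U := by
      simp only [Finset.mem_insert, not_or]; exact ⟨d_y1_y2, hy1U⟩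
    exact (hgood (insert v (insert x2 (insert y1 (insert y2 U))))
      (hins _ hv _ (hins _ hx2 _ (hins _ hy1 _ (hins _ hy2 _ hUS))))
      (by rw [Finset.sum_insert N1, Finset.sum_insert N2,
            Finset.sum_insert N3, Finset.sum_insert hy2U, hU]
          simp only [hx2', hy2']
          exact soloBlind_tri_close three τ (h v) (h x1) (h y1) (0) (0) (0) (0) (by
            (try simp only [zero_smul, add_zero]); abel))).elim
  · have hU : ∑ i ∈ U, h i = τ - (h y1 + h y2) := by rw [← hsplit]; abel
    have N1 : v ∉ insert x1 (insert x2 (insert y1 (insert y2 U))) := by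
      simp only [Finset.mem_insert, not_or]; exact ⟨d_v_x1, d_v_x2, d_v_y1, d_v_y2, hvU⟩
    have N2 : x1 ∉ insert x2 (insert y1 (insert y2 U)) := by
      simp only [Finset.mem_insert, not_or]; exact ⟨d_x1_x2, d_x1_y1, d_x1_y2, hx1U⟩
    have N3 : x2 ∉ insert y1 (insert y2 U) := by
      simp only [Finset.mem_insert, not_or]; exact ⟨d_x2_y1, d_x2_y2, hx2U⟩
    have N4 : y1 ∉ insert y2 U := by
      simp only [Finset.mem_insert, not_or]; exact ⟨d_y1_y2, hy1U⟩
    exact (hgood (insert v (insert x1 (insert x2 (insert y1 (insert y2 U)))))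
      (hins _ hv _ (hins _ hx1 _ (hins _ hx2 _ (hins _ hy1 _ (hins _ hy2 _ hUS)))))
      (by rw [Finset.sum_insert N1, Finset.sum_insert N2, Finset.sum_insert N3,
            Finset.sum_insert N4, Finset.sum_insert hy2U, hU]
          simp only [hx2', hy2']
          exact soloBlind_tri_close three τ (h v) (h x1) (h y1) (0) (0) (0) (0) (by
            (try simp only [zero_smul, add_zero]); abel))).elim
  · have hU : ∑ i ∈ U, h i = τ - (h y1) := by rw [← hsplit]; abel
    have N1 : v ∉ insert x1 (insert x2 (insert y1 U)) := by
      simp only [Finset.mem_insert, not_or]; exact ⟨d_v_x1, d_v_x2, d_v_y1, hvU⟩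
    have N2 : x1 ∉ insert x2 (insert y1 U) := by
      simp only [Finset.mem_insert, not_or]; exact ⟨d_x1_x2, d_x1_y1, hx1U⟩
    have N3 : x2 ∉ insert y1 U := by
      simp only [Finset.mem_insert, not_or]; exact ⟨d_x2_y1, hx2U⟩
    exact (hgood (insert v (insert x1 (insert x2 (insert y1 U))))
      (hins _ hv _ (hins _ hx1 _ (hins _ hx2 _ (hins _ hy1 _ hUS))))
      (by rw [Finset.sum_insert N1, Finset.sum_insert N2,
            Finset.sum_insert N3, Finset.sum_insert hy1U, hU]
          simp only [hx2']
          exact soloBlind_tri_close three τ (h v) (h x1) (h y1) (0) (0) (0) (0) (by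
            (try simp only [zero_smul, add_zero]); abel))).elim
  · have hU : ∑ i ∈ U, h i = τ - (h y2) := by rw [← hsplit]; abel
    have N1 : v ∉ insert x1 (insert x2 (insert y2 U)) := by
      simp only [Finset.mem_insert, not_or]; exact ⟨d_v_x1, d_v_x2, d_v_y2, hvU⟩
    have N2 : x1 ∉ insert x2 (insert y2 U) := by
      simp only [Finset.mem_insert, not_or]; exact ⟨d_x1_x2, d_x1_y2, hx1U⟩
    have N3 : x2 ∉ insert y2 U := by
      simp only [Finset.mem_insert, not_or]; exact ⟨d_x2_y2, hx2U⟩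
    exact (hgood (insert v (insert x1 (insert x2 (insert y2 U))))
      (hins _ hv _ (hins _ hx1 _ (hins _ hx2 _ (hins _ hy2 _ hUS))))
      (by rw [Finset.sum_insert N1, Finset.sum_insert N2,
            Finset.sum_insert N3, Finset.sum_insert hy2U, hU]
          simp only [hx2', hy2']
          exact soloBlind_tri_close three τ (h v) (h x1) (h y1) (0) (0) (0) (0) (by
            (try simp only [zero_smul, add_zero]); abel))).elim
  · have hU : ∑ i ∈ U, h i = τ := hsplit
    have N1 : v ∉ insert x1 (insert x2 U) := by
      simp only [Finset.mem_insert, not_or]; exact ⟨d_v_x1, d_v_x2, hvU⟩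
    have N2 : x1 ∉ insert x2 U := by
      simp only [Finset.mem_insert, not_or]; exact ⟨d_x1_x2, hx1U⟩
    exact (hgood (insert v (insert x1 (insert x2 U)))
      (hins _ hv _ (hins _ hx1 _ (hins _ hx2 _ hUS)))
      (by rw [Finset.sum_insert N1, Finset.sum_insert N2, Finset.sum_insert hx2U, hU]
          simp only [hx2']
          exact soloBlind_tri_close three τ (h v) (h x1) (h y1) (0) (0) (0) (0) (by
            (try simp only [zero_smul, add_zero]); abel))).elim

/-- SHAPE OF THE MEMBERS RELATIVE TO TWO TRIPLES THROUGH A POINT (K3.23.17 (i)): every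
representation `M ⊆ S` of the H-good `τ` in the zero-sum-free `S` (exponent 3) meets the pentad
`{v,x1,x2,y1,y2}` in one of the eighteen admissible patterns. -/
theorem soloBlind_pentad_shape (three : ∀ g : G, g + g + g = 0) {h : ι → G}
    {S : Finset ι} (zsf : ∀ T ⊆ S, T.Nonempty → ∑ i ∈ T, h i ≠ 0) {τ : G}
    (hgood : ∀ T ⊆ S, ∑ i ∈ T, h i ≠ τ + τ)
    {v x1 x2 y1 y2 : ι} (hv : v ∈ S) (hx1 : x1 ∈ S) (hx2 : x2 ∈ S) (hy1 : y1 ∈ S) (hy2 : y2 ∈ S)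
    (d_v_x1 : v ≠ x1) (d_v_x2 : v ≠ x2) (d_v_y1 : v ≠ y1) (d_v_y2 : v ≠ y2) (d_x1_x2 : x1 ≠ x2)
    (d_x1_y1 : x1 ≠ y1) (d_x1_y2 : x1 ≠ y2) (d_x2_y1 : x2 ≠ y1) (d_x2_y2 : x2 ≠ y2)
    (d_y1_y2 : y1 ≠ y2) (hX : h v + h x1 + h x2 = τ) (hY : h v + h y1 + h y2 = τ)
    {M : Finset ι} (hMS : M ⊆ S) (hM : ∑ i ∈ M, h i = τ) :
    soloBlindPentadShape M v x1 x2 y1 y2 := by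
  by_cases mv : v ∈ M
  · exact soloBlind_pentad_shape_of_mem three zsf hx1 hx2 hy1 hy2 d_v_x1 d_v_x2 d_v_y1 d_v_y2
      d_x1_x2 d_x1_y1 d_x1_y2 d_x2_y1 d_x2_y2 d_y1_y2 hX hY hMS hM mv
  · exact soloBlind_pentad_shape_of_not_mem three hgood hv hx1 hx2 hy1 hy2 d_v_x1 d_v_x2
      d_v_y1 d_v_y2 d_x1_x2 d_x1_y1 d_x1_y2 d_x2_y1 d_x2_y2 d_y1_y2 hX hY hMS hM mv

end Summit.MatrixMultiplication.MatrixMultiplication.Theorems
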